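import Literature.Probability.RandomPlanarGeometry.PlanarBrownianAnnulus
import Mathlib.Analysis.SpecialFunctions.JapaneseBracket
import Mathlib.MeasureTheory.Measure.Lebesgue.VolumeOfBalls
import HarnessLib

/-!
# Planar Brownian motion: the expected area of the set of starting points from which a small disc is hit

Proof file (theorems only), continuing `PlanarBrownianAnnulus`. For the planar Brownian motion `Z`
(`BrownianLoop.planarBrownian`), a centre `c`, a radius `a > 0` and a horizon `t ≤ 1`, the quantity

  `S(a) = ∫ P(∃ s ≤ t, w + Z_s ∈ B̄(c, a)) dA(w)`

(the expected area of the Wiener sausage of radius `a` around `Z[0, t]`) tends to `0` as `a → 0`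
— like `π t/ log(1/a)`, by a classical computation we do not reproduce. We prove a crude
parametric bound sufficient for the finiteness of Brownian loop masses
(`lintegral_measure_hit_closedBall_le`): for parameters `a ≤ s₀ ≤ Λ`, `λ ≥ 8`, `Λ ≥ a + 8`, …,

  `S(a) ≤ |B̄(c, s₀)| + |B̄(c, Λ)| · ( (λ/s₀)/log(λ/a) + 2¹² t²/λ⁴ ) + (2¹⁹ t²/Λ) · ∫ (1 + |w|)⁻³ dA(w)`,

from three pointwise bounds on `P_w = P(∃ s ≤ t, w + Z_s ∈ B̄(c, a))`: `P_w ≤ 1` near `c`;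
the `log`-ratio bound of `PlanarBrownianAnnulus` with outer radius `|w − c| + λ` plus the tail of
the running supremum (`Process.measure_max_runSup_ge_le'`) at intermediate distances; the tail of
the running supremum alone far away. (With `s₀ = L^{-1/8}`, `λ = Λ = L^{1/8}`, `L = log(1/a)`,
this is `O(L^{-1/8})`.) No definition and no named fact is introduced.

## References

* J.-F. Le Gall, *Brownian Motion, Martingales, and Stochastic Calculus*, GTM 274 (2016), Ch. 7
  (planar recurrence estimates). [Legall2016]
* F. Spitzer, *Electrostatic capacity, heat flow, and Brownian motion*, Z. Wahrscheinlichkeitstheorie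
  3 (1964) 110–121 (the area of the planar Wiener sausage). [folklore]
-/

noncomputable section

open MeasureTheory ProbabilityTheory Filter Set Metric Complex
open scoped NNReal ENNReal Topology

namespace Literature.Probability.RandomPlanarGeometry

open Literature.Probability.Process
open BrownianLoop (planarBrownian)

/-- `|Z_s(ω)| ≤ |B_s(ω₁)| + |B_s(ω₂)|`. [folklore] -/
theorem norm_planarBrownian_le (s : ℝ≥0) (ω : WienerPair) :
    ‖planarBrownian s ω‖ ≤ |brownian s ω.1| + |brownian s ω.2| := by
  unfold BrownianLoop.planarBrownian
  refine (norm_add_le _ _).trans ?_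
  rw [norm_real, norm_mul, norm_real, norm_I, mul_one, Real.norm_eq_abs, Real.norm_eq_abs]

/-- **The planar path stays within twice the running supremum of the pair**: for `s ≤ t`,
`|Z_s(ω)| ≤ 2 max (runSup t ω₁) (runSup t ω₂)`. [folklore] -/
theorem norm_planarBrownian_le_two_mul_max_runSup {s t : ℝ≥0} (hs : s ≤ t) (ω : WienerPair) :
    ‖planarBrownian s ω‖ ≤ 2 * max (runSup t ω.1) (runSup t ω.2) := by
  have h1 := abs_brownian_le_runSup hs ω.1
  have h2 := abs_brownian_le_runSup hs ω.2
  have := norm_planarBrownian_le s ω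
  have hm1 : runSup t ω.1 ≤ max (runSup t ω.1) (runSup t ω.2) := le_max_left _ _
  have hm2 : runSup t ω.2 ≤ max (runSup t ω.1) (runSup t ω.2) := le_max_right _ _
  linarith

/-- **Reaching distance `x` by time `t ≤ 1` has probability `≤ 2¹² t²/x⁴`** for `x ≥ 8`
(tail of the running supremum of the pair). [cite: RevuzYor1999, Ch. II Thm (1.7)] -/
theorem measure_exists_norm_planarBrownian_ge_le {t : ℝ≥0} (ht : (t : ℝ) ≤ 1) {x : ℝ} (hx : 8 ≤ x) :
    wienerPair {ω | ∃ s ≤ t, x ≤ ‖planarBrownian s ω‖} ≤ ENNReal.ofReal (2 ^ 12 * (t : ℝ) ^ 2 / x ^ 4) := by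
  have hsub : {ω : WienerPair | ∃ s ≤ t, x ≤ ‖planarBrownian s ω‖} ⊆
      {ω | x / 2 ≤ max (runSup t ω.1) (runSup t ω.2)} := by
    rintro ω ⟨s, hs, hxs⟩
    have := norm_planarBrownian_le_two_mul_max_runSup hs ω
    show x / 2 ≤ max (runSup t ω.1) (runSup t ω.2)
    linarith
  refine (measure_mono hsub).trans ((measure_max_runSup_ge_le' ht (by linarith)).trans (le_of_eq ?_))
  congr 1
  field_simp

/-- The far-away pointwise bound: for `|w − c| > Λ ≥ a + 8`, `Λ ≥ 2a`, `Λ ≥ 1`, `t ≤ 1`,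
`P(∃ s ≤ t, w + Z_s ∈ B̄(c, a)) ≤ (2¹⁹ t²/Λ) (1 + |w − c|)⁻³`. [folklore] -/
theorem measure_hit_closedBall_le_far {c w : ℂ} {a Λ : ℝ} {t : ℝ≥0} (ht : (t : ℝ) ≤ 1) (ha : 0 < a)
    (hΛ8 : a + 8 ≤ Λ) (hΛa : 2 * a ≤ Λ) (hΛ1 : 1 ≤ Λ) (hw : Λ < ‖w - c‖) :
    wienerPair {ω | ∃ s ≤ t, w + planarBrownian s ω ∈ closedBall c a} ≤
      ENNReal.ofReal (2 ^ 19 * (t : ℝ) ^ 2 / Λ * (1 + ‖w - c‖) ^ (-(3 : ℝ))) := by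
  set d : ℝ := ‖w - c‖ with hd
  have hd8 : 8 ≤ d - a := by linarith
  have hsub : {ω : WienerPair | ∃ s ≤ t, w + planarBrownian s ω ∈ closedBall c a} ⊆
      {ω | ∃ s ≤ t, d - a ≤ ‖planarBrownian s ω‖} := by
    rintro ω ⟨s, hs, hmem⟩
    refine ⟨s, hs, ?_⟩
    rw [mem_closedBall, dist_eq_norm] at hmem
    have h1 : ‖w - c‖ ≤ ‖w + planarBrownian s ω - c‖ + ‖planarBrownian s ω‖ := by
      have := norm_sub_le_norm_sub_add_norm_sub (w - c) (-(planarBrownian s ω)) 0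
      calc ‖w - c‖ = ‖(w + planarBrownian s ω - c) - planarBrownian s ω‖ := by ring_nf
        _ ≤ ‖w + planarBrownian s ω - c‖ + ‖planarBrownian s ω‖ := norm_sub_le _ _
    linarith
  refine (measure_mono hsub).trans ((measure_exists_norm_planarBrownian_ge_le ht hd8).trans ?_)
  refine ENNReal.ofReal_le_ofReal ?_
  -- `2¹² t²/(d − a)⁴ ≤ 2¹⁹ t²/Λ · (1 + d)⁻³`
  have hd1 : 1 ≤ d := hΛ1.trans hw.le
  have hda : d / 2 ≤ d - a := by linarith
  have h1 : (d / 2) ^ 4 ≤ (d - a) ^ 4 := pow_le_pow_left₀ (by linarith) hda 4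
  have h2 : (1 + d) ^ 3 ≤ 8 * d ^ 3 := by
    calc (1 + d) ^ 3 ≤ (2 * d) ^ 3 := pow_le_pow_left₀ (by linarith) (by linarith) 3
      _ = 8 * d ^ 3 := by ring
  have ht2 : 0 ≤ (t : ℝ) ^ 2 := sq_nonneg _
  rw [Real.rpow_neg (by linarith), show (3 : ℝ) = (3 : ℕ) by norm_num, Real.rpow_natCast]
  rw [div_le_iff₀ (by positivity)]
  calc 2 ^ 12 * (t : ℝ) ^ 2 = (2 ^ 19 * (t : ℝ) ^ 2 / Λ * (8 * d ^ 3)⁻¹) * (Λ * (d / 2) ^ 4 / d) := by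
        field_simp
        ring
    _ ≤ (2 ^ 19 * (t : ℝ) ^ 2 / Λ * ((1 + d) ^ 3)⁻¹) * (d - a) ^ 4 := by
        apply mul_le_mul
        · apply mul_le_mul_of_nonneg_left _ (by positivity)
          exact inv_anti₀ (by positivity) h2
        · calc Λ * (d / 2) ^ 4 / d ≤ d * (d / 2) ^ 4 / d := by gcongr
            _ = (d / 2) ^ 4 := by field_simp
            _ ≤ (d - a) ^ 4 := h1
        · positivity
        · positivity

/-- The intermediate pointwise bound: for `a ≤ s₀ < |w − c|`, `a < λ`, `λ ≥ 8`, `t ≤ 1`,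
`P(∃ s ≤ t, w + Z_s ∈ B̄(c, a)) ≤ (λ/s₀)/log(λ/a) + 2¹² t²/λ⁴` (the `log`-ratio bound with outer
radius `|w − c| + λ`, `log(1 + λ/|w − c|) ≤ λ/s₀`, `log((|w − c| + λ)/a) ≥ log(λ/a)`, and the tail
of the running supremum for reaching distance `λ`). [folklore] -/
theorem measure_hit_closedBall_le_mid {c w : ℂ} {a s₀ lam : ℝ} {t : ℝ≥0} (ht : (t : ℝ) ≤ 1)
    (ha : 0 < a) (has : a ≤ s₀) (hw : s₀ < ‖w - c‖) (hal : a < lam) (hl8 : 8 ≤ lam) :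
    wienerPair {ω | ∃ s ≤ t, w + planarBrownian s ω ∈ closedBall c a} ≤
      ENNReal.ofReal (lam / s₀ / Real.log (lam / a)) + ENNReal.ofReal (2 ^ 12 * (t : ℝ) ^ 2 / lam ^ 4) := by
  set d : ℝ := ‖w - c‖ with hd
  have hs₀ : 0 < s₀ := ha.trans_le has
  have hdpos : 0 < d := hs₀.trans hw
  have hlam : 0 < lam := ha.trans hal
  have had : a < d := has.trans_lt hw
  have h := measure_hit_closedBall_le_log_add (ρ := d + lam) ha had (by linarith) t
  refine h.trans (add_le_add ?_ ?_)
  · refine ENNReal.ofReal_le_ofReal ?_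
    have hlog1 : Real.log ((d + lam) / d) ≤ lam / s₀ := by
      have h1 : Real.log ((d + lam) / d) ≤ (d + lam) / d - 1 := Real.log_le_sub_one_of_pos (by positivity)
      have h2 : (d + lam) / d - 1 = lam / d := by field_simp; ring
      rw [h2] at h1
      exact h1.trans (div_le_div_of_nonneg_left hlam.le hs₀ hw.le)
    have hlog2 : Real.log (lam / a) ≤ Real.log ((d + lam) / a) :=
      Real.log_le_log (by positivity) (by gcongr; linarith)
    have hlogpos : 0 < Real.log (lam / a) := Real.log_pos ((one_lt_div ha).2 hal)
    have hnum : 0 ≤ Real.log ((d + lam) / d) := Real.log_nonneg ((one_le_div hdpos).2 (by linarith))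
    calc Real.log ((d + lam) / d) / Real.log ((d + lam) / a)
        ≤ Real.log ((d + lam) / d) / Real.log (lam / a) := div_le_div_of_nonneg_left hnum hlogpos hlog2
      _ ≤ lam / s₀ / Real.log (lam / a) := div_le_div_of_nonneg_right hlog1 hlogpos.le
  · have hsub : {ω : WienerPair | ∃ s ≤ t, d + lam ≤ ‖w + planarBrownian s ω - c‖} ⊆
        {ω | ∃ s ≤ t, lam ≤ ‖planarBrownian s ω‖} := by
      rintro ω ⟨s, hs, hmem⟩
      refine ⟨s, hs, ?_⟩
      have h1 : ‖w + planarBrownian s ω - c‖ ≤ ‖w - c‖ + ‖planarBrownian s ω‖ := by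
        calc ‖w + planarBrownian s ω - c‖ = ‖(w - c) + planarBrownian s ω‖ := by ring_nf
          _ ≤ ‖w - c‖ + ‖planarBrownian s ω‖ := norm_add_le _ _
      linarith
    exact (measure_mono hsub).trans (measure_exists_norm_planarBrownian_ge_le ht hl8)

/-- **The expected area of the set of starting points from which `B̄(c, a)` is hit by time `t`.**
For `t ≤ 1`, `0 < a ≤ s₀`, `a < λ`, `λ ≥ 8`, `Λ ≥ a + 8`, `Λ ≥ 2a`, `Λ ≥ 1`:

  `∫ P(∃ s ≤ t, w + Z_s ∈ B̄(c, a)) dA(w) ≤ |B̄(c, s₀)| + |B̄(c, Λ)| ((λ/s₀)/log(λ/a) + 2¹² t²/λ⁴)`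
    `+ (2¹⁹ t²/Λ) ∫ (1 + |w|)⁻³ dA(w)`,

with `|B̄(c, s)| = π s²` (`Complex.volume_closedBall`) and the last integral finite
(`finite_integral_one_add_norm`). [folklore] -/
theorem lintegral_measure_hit_closedBall_le {c : ℂ} {a s₀ lam Λ : ℝ} {t : ℝ≥0} (ht : (t : ℝ) ≤ 1)
    (ha : 0 < a) (has : a ≤ s₀) (hal : a < lam) (hl8 : 8 ≤ lam) (hΛ8 : a + 8 ≤ Λ)
    (hΛa : 2 * a ≤ Λ) (hΛ1 : 1 ≤ Λ) :
    ∫⁻ w, wienerPair {ω | ∃ s ≤ t, w + planarBrownian s ω ∈ closedBall c a} ∂(volume : Measure ℂ) ≤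
      ENNReal.ofReal s₀ ^ 2 * NNReal.pi +
        ENNReal.ofReal Λ ^ 2 * NNReal.pi *
          (ENNReal.ofReal (lam / s₀ / Real.log (lam / a)) + ENNReal.ofReal (2 ^ 12 * (t : ℝ) ^ 2 / lam ^ 4)) +
        ENNReal.ofReal (2 ^ 19 * (t : ℝ) ^ 2 / Λ) *
          ∫⁻ w, ENNReal.ofReal ((1 + ‖w‖) ^ (-(3 : ℝ))) ∂(volume : Measure ℂ) := by
  -- the three regions and the piecewise majorant
  set I₁ : Set ℂ := closedBall c s₀ with hI₁
  set I₂ : Set ℂ := closedBall c Λ \ closedBall c s₀ with hI₂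
  set I₃ : Set ℂ := (closedBall c Λ)ᶜ with hI₃
  have hmI₁ : MeasurableSet I₁ := measurableSet_closedBall
  have hmI₂ : MeasurableSet I₂ := measurableSet_closedBall.diff measurableSet_closedBall
  have hmI₃ : MeasurableSet I₃ := measurableSet_closedBall.compl
  set m : ℝ≥0∞ := ENNReal.ofReal (lam / s₀ / Real.log (lam / a)) + ENNReal.ofReal (2 ^ 12 * (t : ℝ) ^ 2 / lam ^ 4)
    with hm
  set far : ℂ → ℝ≥0∞ := fun w ↦ ENNReal.ofReal (2 ^ 19 * (t : ℝ) ^ 2 / Λ) *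
    ENNReal.ofReal ((1 + ‖w - c‖) ^ (-(3 : ℝ))) with hfar
  have hcont3 : Continuous fun w : ℂ ↦ (1 + ‖w - c‖) ^ (-(3 : ℝ)) :=
    (continuous_const.add (continuous_id.sub continuous_const).norm).rpow_const fun w ↦
      Or.inl (ne_of_gt (add_pos_of_pos_of_nonneg one_pos (norm_nonneg _)))
  have hmfar : Measurable far := measurable_const.mul (ENNReal.measurable_ofReal.comp hcont3.measurable)
  set g : ℂ → ℝ≥0∞ := fun w ↦ I₁.indicator (fun _ ↦ (1 : ℝ≥0∞)) w + I₂.indicator (fun _ ↦ m) w + I₃.indicator far w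
    with hg
  -- pointwise domination
  have hdom : ∀ w, wienerPair {ω | ∃ s ≤ t, w + planarBrownian s ω ∈ closedBall c a} ≤ g w := by
    intro w
    by_cases h1 : w ∈ I₁
    · have : I₁.indicator (fun _ ↦ (1 : ℝ≥0∞)) w = 1 := by simp [h1]
      simp only [hg, this]
      exact le_add_right (le_add_right prob_le_one)
    · have hw1 : s₀ < ‖w - c‖ := by
        simpa [hI₁, mem_closedBall, dist_eq_norm, not_le] using h1
      by_cases h3 : w ∈ I₃
      · have hwΛ : Λ < ‖w - c‖ := by
          simpa [hI₃, mem_closedBall, dist_eq_norm, not_le] using h3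
        have : I₃.indicator far w = far w := by simp [h3]
        simp only [hg, this]
        refine le_add_left ?_
        simp only [hfar]
        rw [← ENNReal.ofReal_mul (by positivity)]
        exact measure_hit_closedBall_le_far ht ha hΛ8 hΛa hΛ1 hwΛ
      · have h2 : w ∈ I₂ := by
          refine ⟨?_, h1⟩
          simpa [hI₃] using h3
        have : I₂.indicator (fun _ ↦ m) w = m := by simp [h2]
        simp only [hg, this]
        refine le_add_right (le_add_left ?_)
        exact measure_hit_closedBall_le_mid ht ha has hw1 hal hl8
  -- integrate the majorant
  refine (lintegral_mono hdom).trans ?_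
  simp only [hg]
  rw [lintegral_add_right _ (hmfar.indicator hmI₃), lintegral_add_left (measurable_const.indicator hmI₁),
    lintegral_indicator_const hmI₁, lintegral_indicator_const hmI₂, lintegral_indicator hmI₃, one_mul]
  refine add_le_add (add_le_add ?_ ?_) ?_
  · rw [hI₁, Complex.volume_closedBall]
  · rw [mul_comm]
    gcongr
    calc volume I₂ ≤ volume (closedBall c Λ) := measure_mono sdiff_subset
      _ = ENNReal.ofReal Λ ^ 2 * NNReal.pi := Complex.volume_closedBall c Λ
  · calc ∫⁻ w in I₃, far w ∂volume ≤ ∫⁻ w, far w ∂volume := setLIntegral_le_lintegral _ _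
      _ = ENNReal.ofReal (2 ^ 19 * (t : ℝ) ^ 2 / Λ) *
            ∫⁻ w, ENNReal.ofReal ((1 + ‖w - c‖) ^ (-(3 : ℝ))) ∂(volume : Measure ℂ) := by
          simp only [hfar]
          rw [lintegral_const_mul]
          exact ENNReal.measurable_ofReal.comp hcont3.measurable
      _ = _ := by rw [lintegral_sub_right_eq_self (fun w : ℂ ↦ ENNReal.ofReal ((1 + ‖w‖) ^ (-(3 : ℝ)))) c]

/-- The constant in the far-away term is finite: `∫ (1 + |w|)⁻³ dA(w) < ∞` in the plane
(Mathlib `finite_integral_one_add_norm`, `finrank ℝ ℂ = 2 < 3`). [folklore] -/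
theorem lintegral_one_add_norm_rpow_neg_three_lt_top :
    ∫⁻ w, ENNReal.ofReal ((1 + ‖w‖) ^ (-(3 : ℝ))) ∂(volume : Measure ℂ) < ∞ :=
  finite_integral_one_add_norm (by rw [Complex.finrank_real_complex]; norm_num)

end Literature.Probability.RandomPlanarGeometry

end
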